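import Literature.MathematicalPhysics.QuantumFieldTheory.Balaban1983to89.B9Thm39CinvFinalLoc
import Literature.MathematicalPhysics.QuantumFieldTheory.Balaban1983to89.B9Thm37GpTorusRegularCubes
import Literature.MathematicalPhysics.QuantumFieldTheory.Balaban1983to89.B6Cover236MultiLevelTorusBlocks

/-!
# `Balaban1983to89.B9Thm39CinvAtCover` — [Balaban1985BackgroundPropagators] THEOREM 3.9 pp. 411–413 ⇒ THEOREM 3.2 (3.48) p. 398 FOR
# `C(U) = (Q′G′²Q′*)⁻¹(U)` AT THE CUBE COVER OF RECORD: the end-to-end statement of module M5.6 (FILE 9b) with the cover `𝒟`, the partition `{h_□}` READ ON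
# THE BLOCKS `𝔅`, the characteristic cut-offs `□̃`, the localization sets, the overlap count, the separation of `□̃ᶜ` from `□⁺` and the slow variation of
# `h_□` in the distance (2.46) ALL DISCHARGED from the tree (cell `lit-balaban`, G-B9-LETTERS module M5.6 FILE 10, seat p21 gen 33)

statement-level skeleton of published theorems with citation tags; proofs where landed; nothing here is a claim about the Yang–Mills mass gap

CITATION HEADER (lean-in-tree rule).  B9 = T. Bałaban, *Propagators for lattice gauge theories in a background field*, Commun. Math. Phys. **99** (1985)
389–434 (journal page = PDF page + 388; held `paper:balaban1985-cmp99-background-propagators`; pp. 408–413 re-read by this seat 2026-08-28 on the renders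
`…-p020-x2.png`, `…-p023-x2.png`).  p. 408: «We take a family 𝒟_j of cubes □, with centers at points of this lattice, which are unions of 2ᵈ big blocks … The
family 𝒟 is a partition of the lattice T. We take the partition of unity {h_□} defined at the end of Sect. A in [4]. We have Σ_{□∈𝒟} h²_□ = 1. For a cube □ ∈ 𝒟 and
n = 1, 2, … we define □̃ⁿ as a cube of the size (2 + 2n)MLʲη, and with the same center as □»; p. 409 (3.87) «C₀ = Σ_{□∈𝒟} h_□C_□h_□»; p. 411 (3.95)–(3.96) and «The
characteristic function 1 − □̃ at the beginning of the term, and the function h_□ at the end, restrict a kernel of the term to points separated at least by a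
distance MLʲη (if □ ∈ 𝒟_j)»; p. 412 (3.97), «already localized and give small factors O(M⁻¹)»; p. 413 Theorem 3.9 «For M sufficiently large … This theorem
implies Theorem 3.2»; p. 398 Theorem 3.2 (3.48) «|(Q′(U)G′²(U)Q′*(U))⁻¹(y, y′)| ≦ B₀(Lʲη)⁻⁴(L^{j′}η)^{−d}e^{−δ₀d(y,y′)}, y, y′ ∈ 𝔅»; p. 397 Theorem 3.1 (3.42).
[4] = [Balaban1984PropagatorsII] (2.36) p. 229 («They satisfy Σ_{□∈𝒟} h_□² = 1»), (2.45)–(2.46) p. 231 (the distance d on 𝔅), (2.51)–(2.54) pp. 232–233,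
Lemma 2.1 p. 234, (2.83)–(2.85) pp. 237–238 («h²_□(y) … y ∈ 𝔅», «where we have used the fact that y ∉ □̃′», «gives a factor O(M⁻¹)»).  Rows B9.Thm3.9 ×
B9.Thm3.2 × B9.Def@408 × B9.Eq3.87 × B9.Eq3.95 (cells only; no row head changes).

WHY THIS FILE.  FILE 9b's `hasMajorant_conj_XinvY_of_eBlockInv_loc` displays the cube cover abstractly: an index type, block cut-offs `h_□ : 𝔅 → ℝ` with
`Σh² = 1`, `|h| ≦ 1`, `supp h_□ ⊂ S_□`, overlap `≦ N`, slow variation `|h_□(t′) − h_□(t)| ≦ ℓ₀ + ℓ₁d`, characteristic cut-offs `χ_□` (`= 1` on, `= 0` off `S^χ_□`)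
and the separation `d(a, a″) ≧ D_sep` (`a ∉ S^χ_□`, `a″ ∈ S_□`).  The tree HOLDS all of it for the member's own cover: the block-read partition `h_□(y) := h^T_□(rep y)`
of `B6Cover236MultiLevelTorusBlocks` (p21 gen 17; `sum_hB_sq`, `abs_hB_le_one`, `mem_QT_of_hB_ne_zero`, `abs_hB_sub_le` — Lipschitz constant `2s_T/M`, NO constant
term, in the torus distance (2.46) which IS `geo9K`'s distance, `geo9K_dist_eq`), the sets `□⁺ = QT □` / `□̃ = QbigT □` of `B6Partition118KLevelTorusCentral`
with the gap `(1/(2L²))·M ≦ d_T(Y, Y″)` for `Y ∉ □̃`, `Y″ ∈ □⁺` (`B6Partition118KLevelTorusBinders.gap_QT`), and M5.5 FILE 3's localization sets `SQT` with overlap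
`3·5^{d+1}` (`hcnt_SQT`).  THIS FILE plugs them in: `N = 3·5^{d+1}`, `D_sep = M/(2L²)`, `ℓ₀ = 0`, `ℓ₁ = 2s_T/M`, `χ_□ = 1_{□̃}`, `s = (η²η²)⁻¹`, and the four
distance facts (2.54)/`d(a,a) = 0`/symmetry/`d ≧ 0` of `geo9K` by name — leaving displayed exactly: M5.5's `EBlock`s of `G′`, `G′_□`, the cube letters `C_□` with
their (3.48) blocks `hC` and local inverse property `hloc` (M5.2-E), the LOCALIZED [2]-difference `hD` (GAP G-B9-05), `IsUnit XY`, the transporter/coordinate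
bounds, [4] Lemma 2.1 / the two scale transfers for the member at the chosen rates, the exponent bookkeeping and the located smallness («M sufficiently large»).

WHAT IS PROVED (0 sorry, 0 new named facts; three small `def`s with bodies + `theorem`s).
* §1 `SQbigT □` (indices whose block lies in `□̃`), `chiBigT □ = 1_{□̃}` on `𝔅`, `DsepT = M/(2L²)`, `lipT = 2s_T/M`; membership/0–1/support lemmas; the two
  indicator identities `1_{S^χ_□}∘ιB = 1_{□̃}`, `1_{S_□}∘ιB = 1_{□⁺}` (`= cubeIndT`) under the section `ιB`.
* §2 THE COVER BINDERS DISCHARGED: `sum_hB_sq_blk` (Σh² = 1), `abs_hB_le` (|h| ≦ 1), `hS_cover` (supp ⊂ S_□), `hsep_cover` (the gap `D_sep`), `hLip_cover`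
  (slow variation `ℓ₁d`, `ℓ₀ = 0`), `geo9K_basic` ((2.54), refl, symm, `d ≧ 0`).
* §3 ★★★ `hasMajorant_conj_XinvY_of_eBlockInv_cover` — FILE 9b §3 AT THE COVER OF RECORD: from the `EBlock`s of `G′ = O` and of the `G′_□ = Oc □` (M5.5), `IsUnit XY`,
  contractive transporters, the coordinate bound, the geometry at `((1−α_G)δ_G, α₂)`, `(δ₀, b−ρ)`, `(ρδ₀, α′)` and the two scale transfers, the rate bookkeeping, the
  per-cube `hloc`/`hC`/localized `hD` AT `h_□ = hB`, `χ_□ = 1_{□̃}`, `S_□ = □⁺`, and the located smallness with `N = 3·5^{d+1}`, `D_sep = M/(2L²)`, `ℓ₀ = 0`,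
  `ℓ₁ = 2s_T/M`:  `conj b ((η²η²)⁻¹•(Q′G′²Q′*)⁻¹(U)) ≺ 3·5^{d+1}B₀c₁(ρδ₀,α′)(1 − (θ₁+θ₂+θ₃)c₁)⁻¹·ℓ(a)⁻⁴·e^{−(1−α′)ρδ₀d(a,a′)}`;  ★★★ `norm_XinvY_apply_of_eBlockInv_cover`
  — (3.48)'s printed shape pointwise for one-block sources.

HONEST SCOPE / NOT CLAIMED.  The cover inputs are the tree's constructions for the k-level V1 torus family (reading of record: `h_□` on a block through its
representative site `rep`, [4] p. 237 «h²_□(y) … y ∈ 𝔅»; `□̃` = blocks with chart-centre within `7S/4` of the cube centre; constants `3·5^{d+1}`, `1/(2L²)`,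
`2s_T` explicit, not optimised).  Everything analytic stays displayed as listed above; in particular the [2]-difference estimate (GAP G-B9-05) and Cor. 3.6 for the
cube letters are NOT derived here, and the smallness is located, not derived from a numerical `M`.  Sup-entry (3.48) only.  Finite 𝕋 member of the k-level V1
family (corner-free section `ιB`); nothing continuum, nothing about the mass gap; NOT summit progress.  RELATED, NOT DUPLICATED: FILE 9b (the abstract-cover
statement, USED BY NAME), M5.5 FILE 3 `B9Thm37GpTorusRegularCubes` (the site-level cover of record for `G′(U)`; its `SQT`/`hcnt_SQT` USED BY NAME),
`B6Cover236MultiLevelTorusBlocks` / `B6Partition118KLevelTorus*` (the cover, USED BY NAME).  Searched 2026-08-28: `lean search 'CinvAtCover|SQbigT|chiBigT' --decl` = ∅.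
-/

noncomputable section

namespace Literature.MathematicalPhysics.QuantumFieldTheory.Balaban1983to89.B9Thm39CinvAtCover

open Node00 B9CubeLettersInvReadings
open B6Geom246MultiLevelBox (bset blkOf)
open B6Geom246MultiLevelTorus (bondT geomT)
open B6Cover236MultiLevelBlocks (cubes)
open B6Cover236MultiLevelTorusBlocks (hB sum_hB_sq abs_hB_le_one mem_QT_of_hB_ne_zero abs_hB_sub_le cubeIndT)
open B6Partition118KLevelTorusCentral (QT QbigT QT_subset_QbigT)
open B6Partition118KLevelTorusBinders (sLipT sLipT_nonneg gap_QT M_pos)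
open B6Ineq2142KLevelV1 (β)
open B6KLevelCensusIndexV1 (KIdx)
open B6RandomWalk (HasMajorant Triangle254 Ineq261 Ineq263 hasMajorant_mono)
open B9Thm34Ext (toB6)
open B9FromB6 (EBlock)
open B9GeoNormsKLevelV1 (geo9K)
open B9GeoLemma21KLevelV1 (one_le_Mh one_le_P geo9K_dist_eq geo9K_dist_self geo9K_dist_comm geo9K_dist_nonneg' geo9K_dist_triangle)
open B9Eq352DivFormLetters (conj)
open B9Thm37CubeCoverCommutators (cutMulY)
open B9Thm37CubeCoverCommutatorSizes (side_conditions four_le_P')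
open B9Thm37GpTorusRegularCubes (SQT mem_SQT hcnt_SQT)
open B9Ineq349SiteComposite (etaS_pos)
open B9Thm39CinvTorusRegular (norm_apply_le_of_hasMajorant_blk)
open B9Thm39CinvFinalLoc (hasMajorant_conj_XinvY_of_eBlockInv_loc)

variable {d ℓ : ℕ} {hd : 1 ≤ d + 1} {hL : Odd (ℓ + 1) ∧ 1 < ℓ + 1} {b₀ b₁ : ℝ}
variable {𝔸 : Type} [NormedRing 𝔸] [NormedAlgebra ℂ 𝔸] [CompleteSpace 𝔸]
variable {ι : Type} [Fintype ι] [DecidableEq ι]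
variable (i : KIdx d ℓ hd hL b₀ b₁) (b : Module.Basis ι ℝ 𝔸)
variable [Fintype (geo9K i).Site] [DecidableEq (geo9K i).Site] {Rr : ℝ} {Hp : Prop}

/-! ## §1 The sets and cut-offs of the cover of record in FILE 9b's currency -/

/-- **`S^χ_□`**: the carrier indices whose block lies in `□̃ = QbigT □` (a definite `Finset`, companion of M5.5 FILE 3's `SQT`).
[cite: Balaban1985BackgroundPropagators, p.408 («□̃ⁿ … with the same center as □»), (3.95) p.411, dictionary] -/
def SQbigT (c : ↥(cubes i.D.toDomains)) : Finset (geo9K i).Site :=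
  Finset.univ.filter fun a => β i.hN i.D i.hk a ∈ QbigT i.D (one_le_Mh i) (four_le_P' i) c

/-- **`χ_□ := 1_{□̃}` ON THE BLOCKS `𝔅`** — the characteristic function «□̃» of (3.95). [cite: Balaban1985BackgroundPropagators, (3.95) p.411 («Σ_□ □̃Q′(G′² − G′²_□)Q′*h_□C_□h_□»)] -/
def chiBigT (c : ↥(cubes i.D.toDomains)) (t : BlkY i) : ℝ :=
  if t ∈ QbigT i.D (one_le_Mh i) (four_le_P' i) c then 1 else 0

/-- **`D_sep := M/(2L²)`** (`M = L·M_h`): the separation of `□̃ᶜ` from `□⁺` in the distance (2.46) (`B6Partition118KLevelTorusBinders.gap_QT`). OURS (explicit constant).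
[cite: Balaban1985BackgroundPropagators, p.411 («separated at least by a distance MLʲη»); Balaban1984PropagatorsII, (2.83) p.237] -/
def DsepT : ℝ := 1 / (2 * ((ℓ : ℝ) + 1) ^ 2) * (((ℓ : ℝ) + 1) * (i.Mh : ℝ))

/-- **`ℓ₁ := 2s_T/M`**: the Lipschitz constant of the block-read `h_□` in the distance (2.46) (`B6Cover236MultiLevelTorusBlocks.abs_hB_sub_le`). OURS (explicit constant).
[cite: Balaban1985BackgroundPropagators, p.412 («give small factors O(M⁻¹)»); Balaban1984PropagatorsII, p.238 («gives a factor O(M⁻¹)»)] -/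
def lipT : ℝ := 2 * sLipT d ℓ / (((ℓ : ℝ) + 1) * (i.Mh : ℝ))

omit [DecidableEq ι] [DecidableEq (geo9K i).Site] in
/-- membership in `S^χ_□`. [cite: Balaban1985BackgroundPropagators, (3.95) p.411, bookkeeping] -/
theorem mem_SQbigT (c : ↥(cubes i.D.toDomains)) (a : (geo9K i).Site) :
    a ∈ SQbigT i c ↔ β i.hN i.D i.hk a ∈ QbigT i.D (one_le_Mh i) (four_le_P' i) c := by
  simp only [SQbigT, Finset.mem_filter, Finset.mem_univ, true_and]

omit [Fintype ι] [DecidableEq ι] [Fintype (geo9K i).Site] [DecidableEq (geo9K i).Site] in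
/-- `0 ≦ χ_□ ≦ 1`. [cite: Balaban1985BackgroundPropagators, (3.95) p.411, bookkeeping] -/
theorem chiBigT_01 (c : ↥(cubes i.D.toDomains)) (t : BlkY i) : 0 ≤ chiBigT i c t ∧ chiBigT i c t ≤ 1 := by
  unfold chiBigT; split_ifs <;> norm_num

omit [DecidableEq ι] [DecidableEq (geo9K i).Site] in
/-- `χ_□ = 1` over `S^χ_□` (through the section `ιB`). [cite: Balaban1985BackgroundPropagators, (3.95) p.411, bookkeeping] -/
theorem chiBigT_eq_one (ιB : BlkY i → IBondY i) (hι : ∀ s, β i.hN i.D i.hk (ιB s) = s) (c : ↥(cubes i.D.toDomains)) (t : BlkY i)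
    (ht : ιB t ∈ SQbigT i c) : chiBigT i c t = 1 := by
  have ht' := (mem_SQbigT i c (ιB t)).1 ht
  rw [hι] at ht'
  unfold chiBigT; rw [if_pos ht']

omit [DecidableEq ι] [DecidableEq (geo9K i).Site] in
/-- `supp χ_□ ⊂ S^χ_□` (through `ιB`): `χ_□` IS the characteristic function of `□̃`. [cite: Balaban1985BackgroundPropagators, (3.95) p.411, bookkeeping] -/
theorem chiBigT_supp (ιB : BlkY i → IBondY i) (hι : ∀ s, β i.hN i.D i.hk (ιB s) = s) (c : ↥(cubes i.D.toDomains)) (t : BlkY i)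
    (ht : chiBigT i c t ≠ 0) : ιB t ∈ SQbigT i c := by
  refine (mem_SQbigT i c (ιB t)).2 ?_
  rw [hι]
  by_contra hn
  exact ht (by unfold chiBigT; rw [if_neg hn])

omit [DecidableEq ι] in
/-- the `S^χ_□`-indicator pulled back along `ιB` IS `1_{□̃}`. [cite: Balaban1985BackgroundPropagators, (3.95) p.411, bookkeeping] -/
theorem indicator_SQbigT_eq (ιB : BlkY i → IBondY i) (hι : ∀ s, β i.hN i.D i.hk (ιB s) = s) (c : ↥(cubes i.D.toDomains)) :
    (fun t : BlkY i => if ιB t ∈ SQbigT i c then (1 : ℝ) else 0) = chiBigT i c := by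
  funext t
  unfold chiBigT
  exact if_congr ((mem_SQbigT i c (ιB t)).trans (by rw [hι])) rfl rfl

omit [DecidableEq ι] in
/-- the `S_□`-indicator pulled back along `ιB` IS `1_{□⁺}` (`cubeIndT`). [cite: Balaban1985BackgroundPropagators, (3.87) p.409; Balaban1984PropagatorsII, (2.82) p.237, bookkeeping] -/
theorem indicator_SQT_eq (ιB : BlkY i → IBondY i) (hι : ∀ s, β i.hN i.D i.hk (ιB s) = s) (c : ↥(cubes i.D.toDomains)) :
    (fun t : BlkY i => if ιB t ∈ SQT i c then (1 : ℝ) else 0) = cubeIndT i.D (one_le_Mh i) (four_le_P' i) c := by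
  funext t
  unfold cubeIndT
  exact if_congr ((mem_SQT i c (ιB t)).trans (by rw [hι])) rfl rfl

/-! ## §2 The cover binders of FILE 9b, discharged for the cover of record -/

omit [Fintype ι] [DecidableEq ι] [Fintype (geo9K i).Site] [DecidableEq (geo9K i).Site] in
/-- **`Σ_□ h_□(y)² = 1` on `𝔅`** (p. 408 «We have Σ h²_□ = 1»; [4] (2.36)). [cite: Balaban1985BackgroundPropagators, p.408; Balaban1984PropagatorsII, (2.36) p.229] -/
theorem sum_hB_sq_blk (t : BlkY i) : ∑ c, hB i.D c t ^ 2 = 1 := sum_hB_sq i.D (one_le_Mh i) (one_le_P i) t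

omit [Fintype ι] [DecidableEq ι] [Fintype (geo9K i).Site] [DecidableEq (geo9K i).Site] in
/-- `|h_□| ≦ 1` on `𝔅`. [cite: Balaban1984PropagatorsII, (2.36) p.229, bookkeeping] -/
theorem abs_hB_le (c : ↥(cubes i.D.toDomains)) (t : BlkY i) : |hB i.D c t| ≤ 1 := abs_hB_le_one i.D (one_le_Mh i) (one_le_P i) c t

omit [DecidableEq ι] [DecidableEq (geo9K i).Site] in
/-- **`supp h_□ ⊂ S_□ = □⁺`** through `ιB`. [cite: Balaban1984PropagatorsII, p.235, (2.83) p.237 («y″ ∈ supp h_□′»), bookkeeping] -/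
theorem hS_cover (ιB : BlkY i → IBondY i) (hι : ∀ s, β i.hN i.D i.hk (ιB s) = s) (c : ↥(cubes i.D.toDomains)) (t : BlkY i)
    (ht : hB i.D c t ≠ 0) : ιB t ∈ SQT i c := by
  obtain ⟨_, hMh2, hR, _⟩ := side_conditions i
  refine (mem_SQT i c (ιB t)).2 ?_
  rw [hι]
  exact mem_QT_of_hB_ne_zero i.D hMh2 hR (one_le_Mh i) (four_le_P' i) ht

omit [DecidableEq ι] [DecidableEq (geo9K i).Site] in
/-- **THE SEPARATION** («separated at least by a distance MLʲη»): for `a ∉ S^χ_□` and `a″ ∈ S_□`, `D_sep = M/(2L²) ≦ d(a, a″)` — the torus gap between `□̃ᶜ` and `□⁺`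
read at the carrier blocks. [cite: Balaban1985BackgroundPropagators, p.411; Balaban1984PropagatorsII, (2.83) p.237 («where we have used the fact that y ∉ □̃′»), (2.46) p.231] -/
theorem hsep_cover (c : ↥(cubes i.D.toDomains)) (a : (geo9K i).Site) (ha : a ∉ SQbigT i c) (a'' : (geo9K i).Site) (ha'' : a'' ∈ SQT i c) :
    DsepT i ≤ (geo9K i).dist a a'' := by
  obtain ⟨hℓ1, hMh2, hR, hP5⟩ := side_conditions i
  have ha' : β i.hN i.D i.hk a ∉ QbigT i.D (one_le_Mh i) (four_le_P' i) c := fun hm => ha ((mem_SQbigT i c a).2 hm)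
  have ha''' := (mem_SQT i c a'').1 ha''
  rw [geo9K_dist_eq]
  exact gap_QT (D := i.D) hℓ1 hMh2 hR hP5 c ha' ha'''

omit [DecidableEq ι] [Fintype (geo9K i).Site] [DecidableEq (geo9K i).Site] in
/-- **THE SLOW VARIATION OF `h_□` ON `𝔅`** («give small factors O(M⁻¹)»): `|h_□(t′) − h_□(t)| ≦ 0 + (2s_T/M)·d(ιB t, ιB t′)` in `geo9K`'s distance (2.46).
[cite: Balaban1985BackgroundPropagators, p.412; Balaban1984PropagatorsII, p.238 («gives a factor O(M⁻¹)»), (2.84) p.237, (2.46) p.231] -/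
theorem hLip_cover (ιB : BlkY i → IBondY i) (hι : ∀ s, β i.hN i.D i.hk (ιB s) = s) (c : ↥(cubes i.D.toDomains)) (t t' : BlkY i) :
    |hB i.D c t' - hB i.D c t| ≤ 0 + lipT i * (geo9K i).dist (ιB t) (ιB t') := by
  obtain ⟨hℓ1, hMh2, hR, hP5⟩ := side_conditions i
  rw [zero_add, geo9K_dist_eq, hι, hι, SimpleGraph.dist_comm]
  exact abs_hB_sub_le i.D hℓ1 hMh2 hR hP5 c t' t

omit [Fintype ι] [DecidableEq ι] [DecidableEq (geo9K i).Site] in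
/-- the four distance facts of the reading — (2.54), `d(a,a) = 0`, symmetry, `d ≧ 0` — hold for `geo9K i` (p21's `B9GeoLemma21KLevelV1`, by name).
[cite: Balaban1984PropagatorsII, (2.46) p.231 + (2.54) p.233] -/
theorem geo9K_basic : Triangle254 (toB6 (geo9K i) Rr Hp) ∧ (∀ y : (geo9K i).Site, (geo9K i).dist y y = 0) ∧
    (∀ a a' : (geo9K i).Site, (geo9K i).dist a a' = (geo9K i).dist a' a) ∧ (∀ a a' : (geo9K i).Site, 0 ≤ (geo9K i).dist a a') :=
  ⟨(B9Thm34Ext.triangle254_toB6_iff (geo9K i) Rr Hp).2 (geo9K_dist_triangle i), geo9K_dist_self i, geo9K_dist_comm i, geo9K_dist_nonneg' i⟩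

omit [Fintype ι] [DecidableEq ι] [Fintype (geo9K i).Site] [DecidableEq (geo9K i).Site] in
/-- `0 ≦ D_sep`. [cite: Balaban1984PropagatorsII, (2.83) p.237, bookkeeping] -/
theorem DsepT_nonneg : 0 ≤ DsepT i := by
  unfold DsepT; positivity

omit [Fintype ι] [DecidableEq ι] [Fintype (geo9K i).Site] [DecidableEq (geo9K i).Site] in
/-- `0 ≦ ℓ₁ = 2s_T/M`. [cite: Balaban1984PropagatorsII, p.238, bookkeeping] -/
theorem lipT_nonneg : 0 ≤ lipT i := by
  unfold lipT
  exact div_nonneg (mul_nonneg (by norm_num) (sLipT_nonneg d ℓ)) (M_pos (ℓ := ℓ) (one_le_Mh i)).le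

/-! ## §3 ★★★ Theorem 3.9 ⇒ Theorem 3.2 (3.48) for `C(U)` at the cube cover of record -/

section Main

variable {B : B9.Backgrounds} (cfg : B.Cfg → CfgY 𝔸 i) (O : SiteOpY 𝔸 i) (parS : SiteParY 𝔸 i) {U₁ : B.Cfg}
variable (ιB : BlkY i → IBondY i)

/-- ★★★ **THEOREM 3.9 ⇒ THEOREM 3.2 (3.48) FOR `C(U) = (Q′G′²Q′*)⁻¹(U)` AT THE CUBE COVER OF RECORD, FROM THEOREM 3.1's (3.42) BLOCKS OF `G′(U)` AND OF THE `G′_□(U)`**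
(FILE 9b `hasMajorant_conj_XinvY_of_eBlockInv_loc` with `h_□ := hB i.D □` — «We take the partition of unity {h_□} … Σh²_□ = 1», read on 𝔅 —, `χ_□ := 1_{□̃}`, `S_□ := □⁺`,
`S^χ_□ := □̃`, `N := 3·5^{d+1}`, `D_sep := M/(2L²)`, `ℓ₀ := 0`, `ℓ₁ := 2s_T/M`, `s := (η²η²)⁻¹`, and the four distance facts of `geo9K` discharged): from the `EBlock`s of
`G′ = O` and of every cube letter `G′_□ = Oc □` over the invariant class (M5.5), a section `ιB` of `β`, `IsUnit (XY i parS O U)`, contractive transporters, the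
coordinate bound `M₂` of `b`, the scale transfer of `ℓ²` at `α_G` with (2.61) at `((1−α_G)δ_G, α₂)`, the target rate `a_Lδ₀ ≦ (1−α₂)(1−α_G)δ_G`, the per-cube
local inverse property `hloc` and (3.48) blocks `hC` of the `C_□ = Cl □` at `h_□`, `1_{□̃}`, the LOCALIZED [2]-difference majorants `hD` of
`conj b ((η²η²)•(M_{1_{□̃}}(XY G′ − XY G′_□)M_{1_{□⁺}}))` (GAP G-B9-05), the scale transfer of `ℓ⁻⁴` at `α_st`, (2.61) at `(δ₀, b−ρ)`, (2.61)/(2.63) at `(ρδ₀, α′)`,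
the exponent splits and the located smallness `(θ₁+θ₂+θ₃)c₁(ρδ₀, α′) < 1` («M sufficiently large») ⟹
`conj b ((η²η²)⁻¹•(XinvY i parS O U)) ≺ 3·5^{d+1}·B₀·c₁(ρδ₀,α′)(1 − (θ₁+θ₂+θ₃)c₁(ρδ₀,α′))⁻¹·ℓ(a)⁻⁴·e^{−(1−α′)ρδ₀d(a,a′)}` on the block carrier `(t, j) ↦ ιB t`.
[cite: Balaban1985BackgroundPropagators, Thm 3.9 p.413 + (3.95)–(3.97) pp.411–412 + (3.87) p.409 + p.408 + Thm 3.1 (3.42) p.397 + Thm 3.2 (3.48) p.398;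
Balaban1984PropagatorsII, (2.36) p.229 + Lemma 2.1 p.234 + (2.83)–(2.85) pp.237–238] -/
theorem hasMajorant_conj_XinvY_of_eBlockInv_cover (Oc : ↥(cubes i.D.toDomains) → SiteOpY 𝔸 i)
    {BG δG : ℝ} (hE : EBlock (kernelFamilySInv i B cfg O parS) BG δG U₁) (hEc : ∀ c, EBlock (kernelFamilySInv i B cfg (Oc c) parS) BG δG U₁)
    (hBG : 0 ≤ BG) (hι : ∀ s, β i.hN i.D i.hk (ιB s) = s)
    (hunit : IsUnit (XY i parS O (cfg U₁)))
    (hpar : ∀ z w : SiteY i, ‖(parS (cfg U₁) z w : 𝔸)‖ ≤ 1 ∧ ‖(((parS (cfg U₁) z w)⁻¹ : 𝔸ˣ) : 𝔸)‖ ≤ 1)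
    {M₂ : ℝ} (hM₂ : 0 ≤ M₂) (hrepr : ∀ (v : 𝔸) (j : ι), |b.repr v j| ≤ M₂ * ‖v‖) (d' d₂ : ℕ)
    {αG α₂ CG : ℝ} (hCG : 0 ≤ CG) (hαGδ : 0 ≤ αG * δG) (hα₂0 : 0 ≤ α₂) (hα₂1 : α₂ ≤ 1) (hδG : 0 ≤ (1 - αG) * δG)
    (hSTG : B9Ineq347.ScaleTransfer (geo9K i) δG αG CG (fun a => (geo9K i).len a ^ 2))
    (h261G : Ineq261 d₂ (toB6 (geo9K i) Rr Hp) ((1 - αG) * δG) α₂)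
    {δ₀ aL aD αc αst asep ρ bb κG κD B₀ C α' θ₁ θ₂ θ₃ : ℝ} (hrate : aL * δ₀ ≤ (1 - α₂) * ((1 - αG) * δG))
    (Cl : ↥(cubes i.D.toDomains) → Module.End ℝ (BlkY i → 𝔸))
    (hκD : 0 ≤ κD) (hB₀ : 0 ≤ B₀) (hC0 : 0 ≤ C)
    (hδ₀ : 0 ≤ δ₀) (hasep : 0 ≤ asep) (hρ : 0 ≤ ρ) (hρb : ρ ≤ bb) (hαc : 0 < αc * δ₀) (hα'1 : α' ≤ 1)
    (hsplit₁ : αst + asep + ρ ≤ aL) (hsplit₂ : αst + ρ ≤ aD) (hsplit₃ : αst + αc + ρ ≤ aL)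
    (hκG : κG = (M₂ * (∑ j, ‖b j‖) * BG) ^ 2 * CG * B6.c1 d₂ ((1 - αG) * δG) α₂)
    (hθ₁ : θ₁ = (3 * 5 ^ (d + 1)) * (((M₂ * ∑ j, ‖b j‖) ^ 2 * κG) * B₀ * C * B6.c1 d' δ₀ (bb - ρ) * Real.exp (-(asep * δ₀ * DsepT i))))
    (hθ₂ : θ₂ = (3 * 5 ^ (d + 1)) * (κD * Real.exp (-(2 * δ₀ * DsepT i)) * B₀ * C * B6.c1 d' δ₀ (bb - ρ)))
    (hθ₃ : θ₃ = (3 * 5 ^ (d + 1)) * ((lipT i * (αc * δ₀)⁻¹) * ((M₂ * ∑ j, ‖b j‖) ^ 2 * κG) * B₀ * C * B6.c1 d' δ₀ (bb - ρ)))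
    (hST : B9Ineq347.ScaleTransfer (geo9K i) δ₀ αst C (fun a => ((geo9K i).len a ^ 4)⁻¹)) (h261b : Ineq261 d' (toB6 (geo9K i) Rr Hp) δ₀ (bb - ρ))
    (h261 : Ineq261 d' (toB6 (geo9K i) Rr Hp) (ρ * δ₀) α') (h263 : Ineq263 d' (toB6 (geo9K i) Rr Hp) (ρ * δ₀) α')
    (hsmall : (θ₁ + θ₂ + θ₃) * B6.c1 d' (ρ * δ₀) α' < 1)
    (hloc : ∀ c, (cutMulY (𝔸 := 𝔸) (hB i.D c)).restrictScalars ℝ *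
      ((cutMulY (𝔸 := 𝔸) (chiBigT i c)).restrictScalars ℝ * (XY i parS (Oc c) (cfg U₁)).restrictScalars ℝ) * Cl c *
        (cutMulY (𝔸 := 𝔸) (hB i.D c)).restrictScalars ℝ =
      (cutMulY (𝔸 := 𝔸) (hB i.D c)).restrictScalars ℝ * (cutMulY (𝔸 := 𝔸) (hB i.D c)).restrictScalars ℝ)
    (hC : ∀ c, HasMajorant (g := toB6 (geo9K i) Rr Hp) (fun p : BlkY i × ι => ιB p.1) (conj b ((etaS i ^ 2 * etaS i ^ 2)⁻¹ • Cl c))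
      (fun a a' => B₀ * ((geo9K i).len a ^ 4)⁻¹ * Real.exp (-(bb * δ₀ * (geo9K i).dist a a'))))
    (hD : ∀ c, HasMajorant (g := toB6 (geo9K i) Rr Hp) (fun p : BlkY i × ι => ιB p.1)
      (conj b ((etaS i ^ 2 * etaS i ^ 2) • ((cutMulY (𝔸 := 𝔸) (chiBigT i c)).restrictScalars ℝ *
        ((XY i parS O (cfg U₁)).restrictScalars ℝ - (XY i parS (Oc c) (cfg U₁)).restrictScalars ℝ) *
        (cutMulY (𝔸 := 𝔸) (cubeIndT i.D (one_le_Mh i) (four_le_P' i) c)).restrictScalars ℝ)))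
      (fun a a'' => κD * Real.exp (-(2 * δ₀ * DsepT i)) * (geo9K i).len a ^ 4 * Real.exp (-(aD * δ₀ * (geo9K i).dist a a'')))) :
    HasMajorant (g := toB6 (geo9K i) Rr Hp) (fun p : BlkY i × ι => ιB p.1)
      (conj b ((etaS i ^ 2 * etaS i ^ 2)⁻¹ • (XinvY i parS O (cfg U₁)).restrictScalars ℝ))
      (fun a a' => (3 * 5 ^ (d + 1)) * B₀ * B6.c1 d' (ρ * δ₀) α' * (1 - (θ₁ + θ₂ + θ₃) * B6.c1 d' (ρ * δ₀) α')⁻¹ * ((geo9K i).len a ^ 4)⁻¹ *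
        Real.exp (-((1 - α') * (ρ * δ₀) * (geo9K i).dist a a'))) := by
  obtain ⟨htri, hrefl, hsymm, hdnn⟩ := geo9K_basic i (Rr := Rr) (Hp := Hp)
  have hη : etaS i ^ 2 * etaS i ^ 2 ≠ 0 := ne_of_gt (mul_pos (pow_pos (etaS_pos i) 2) (pow_pos (etaS_pos i) 2))
  -- the localized [2]-difference at FILE 9b's indicator cut-offs `1_{S^χ_□}∘ιB = 1_{□̃}`, `1_{S_□}∘ιB = 1_{□⁺}`
  have hD' : ∀ c, HasMajorant (g := toB6 (geo9K i) Rr Hp) (fun p : BlkY i × ι => ιB p.1)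
      (conj b ((etaS i ^ 2 * etaS i ^ 2) • ((cutMulY (𝔸 := 𝔸) (fun t : BlkY i => if ιB t ∈ SQbigT i c then (1 : ℝ) else 0)).restrictScalars ℝ *
        ((XY i parS O (cfg U₁)).restrictScalars ℝ - (XY i parS (Oc c) (cfg U₁)).restrictScalars ℝ) *
        (cutMulY (𝔸 := 𝔸) (fun t : BlkY i => if ιB t ∈ SQT i c then (1 : ℝ) else 0)).restrictScalars ℝ)))
      (fun a a'' => κD * Real.exp (-(2 * δ₀ * DsepT i)) * (geo9K i).len a ^ 4 * Real.exp (-(aD * δ₀ * (geo9K i).dist a a''))) := fun c => by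
    rw [indicator_SQbigT_eq i ιB hι c, indicator_SQT_eq i ιB hι c]
    exact hD c
  exact hasMajorant_conj_XinvY_of_eBlockInv_loc i b ιB cfg O parS Oc hE hEc hBG hι hunit hpar hM₂ hrepr d' d₂ hCG hαGδ hα₂0 hα₂1 hδG hSTG h261G hrate
    (fun c => SQbigT i c) (fun c => SQT i c) (fun c => chiBigT i c) (fun c => hB i.D c) Cl (mul_inv_cancel₀ hη) hκD le_rfl (lipT_nonneg i) hB₀ hC0
    (by positivity) hδ₀ hasep hρ hρb hαc hα'1 hsplit₁ hsplit₂ hsplit₃ hκG hθ₁ hθ₂ (by rw [zero_add]; exact hθ₃) htri hrefl hsymm hdnn hST h261b h261 h263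
    hsmall (sum_hB_sq_blk i) (abs_hB_le i) (hS_cover i ιB hι) (hcnt_SQT i) (chiBigT_01 i) (chiBigT_eq_one i ιB hι) (chiBigT_supp i ιB hι)
    (hsep_cover i) (hLip_cover i ιB hι) hloc hC hD'

/-- ★★★ **THEOREM 3.2 (3.48) FOR `C(U)` POINTWISE AT THE CUBE COVER OF RECORD** («|(Q′(U)G′²(U)Q′*(U))⁻¹(y, y′)| ≦ B₀(Lʲη)⁻⁴(L^{j′}η)^{−d}e^{−δ₀d(y,y′)}», constant and rate
explicit, in def-Y's lattice units with the scale weight `(η²η²)⁻¹`): under the hypotheses of `hasMajorant_conj_XinvY_of_eBlockInv_cover`, every source `λ` supported at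
one block `s₀` with `‖λ(s₀)‖ ≦ 1` obeys `(η²η²)⁻¹·‖(XinvY i parS O U λ)(t)‖ ≦ (Σ_j‖b_j‖)M₂·[3·5^{d+1}B₀c₁(ρδ₀,α′)(1 − (θ₁+θ₂+θ₃)c₁)⁻¹]·ℓ(ιB t)⁻⁴·e^{−(1−α′)ρδ₀·d(ιB t, ιB s₀)}`.
[cite: Balaban1985BackgroundPropagators, Thm 3.2 (3.48) p.398 via Thm 3.9 p.413 + Thm 3.1 (3.42) p.397; Balaban1984PropagatorsII, (2.51) p.232] -/
theorem norm_XinvY_apply_of_eBlockInv_cover (Oc : ↥(cubes i.D.toDomains) → SiteOpY 𝔸 i)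
    {BG δG : ℝ} (hE : EBlock (kernelFamilySInv i B cfg O parS) BG δG U₁) (hEc : ∀ c, EBlock (kernelFamilySInv i B cfg (Oc c) parS) BG δG U₁)
    (hBG : 0 ≤ BG) (hι : ∀ s, β i.hN i.D i.hk (ιB s) = s)
    (hunit : IsUnit (XY i parS O (cfg U₁)))
    (hpar : ∀ z w : SiteY i, ‖(parS (cfg U₁) z w : 𝔸)‖ ≤ 1 ∧ ‖(((parS (cfg U₁) z w)⁻¹ : 𝔸ˣ) : 𝔸)‖ ≤ 1)
    {M₂ : ℝ} (hM₂ : 0 ≤ M₂) (hrepr : ∀ (v : 𝔸) (j : ι), |b.repr v j| ≤ M₂ * ‖v‖) (d' d₂ : ℕ)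
    {αG α₂ CG : ℝ} (hCG : 0 ≤ CG) (hαGδ : 0 ≤ αG * δG) (hα₂0 : 0 ≤ α₂) (hα₂1 : α₂ ≤ 1) (hδG : 0 ≤ (1 - αG) * δG)
    (hSTG : B9Ineq347.ScaleTransfer (geo9K i) δG αG CG (fun a => (geo9K i).len a ^ 2))
    (h261G : Ineq261 d₂ (toB6 (geo9K i) Rr Hp) ((1 - αG) * δG) α₂)
    {δ₀ aL aD αc αst asep ρ bb κG κD B₀ C α' θ₁ θ₂ θ₃ : ℝ} (hrate : aL * δ₀ ≤ (1 - α₂) * ((1 - αG) * δG))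
    (Cl : ↥(cubes i.D.toDomains) → Module.End ℝ (BlkY i → 𝔸))
    (hκD : 0 ≤ κD) (hB₀ : 0 ≤ B₀) (hC0 : 0 ≤ C)
    (hδ₀ : 0 ≤ δ₀) (hasep : 0 ≤ asep) (hρ : 0 ≤ ρ) (hρb : ρ ≤ bb) (hαc : 0 < αc * δ₀) (hα'1 : α' ≤ 1)
    (hsplit₁ : αst + asep + ρ ≤ aL) (hsplit₂ : αst + ρ ≤ aD) (hsplit₃ : αst + αc + ρ ≤ aL)
    (hκG : κG = (M₂ * (∑ j, ‖b j‖) * BG) ^ 2 * CG * B6.c1 d₂ ((1 - αG) * δG) α₂)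
    (hθ₁ : θ₁ = (3 * 5 ^ (d + 1)) * (((M₂ * ∑ j, ‖b j‖) ^ 2 * κG) * B₀ * C * B6.c1 d' δ₀ (bb - ρ) * Real.exp (-(asep * δ₀ * DsepT i))))
    (hθ₂ : θ₂ = (3 * 5 ^ (d + 1)) * (κD * Real.exp (-(2 * δ₀ * DsepT i)) * B₀ * C * B6.c1 d' δ₀ (bb - ρ)))
    (hθ₃ : θ₃ = (3 * 5 ^ (d + 1)) * ((lipT i * (αc * δ₀)⁻¹) * ((M₂ * ∑ j, ‖b j‖) ^ 2 * κG) * B₀ * C * B6.c1 d' δ₀ (bb - ρ)))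
    (hST : B9Ineq347.ScaleTransfer (geo9K i) δ₀ αst C (fun a => ((geo9K i).len a ^ 4)⁻¹)) (h261b : Ineq261 d' (toB6 (geo9K i) Rr Hp) δ₀ (bb - ρ))
    (h261 : Ineq261 d' (toB6 (geo9K i) Rr Hp) (ρ * δ₀) α') (h263 : Ineq263 d' (toB6 (geo9K i) Rr Hp) (ρ * δ₀) α')
    (hsmall : (θ₁ + θ₂ + θ₃) * B6.c1 d' (ρ * δ₀) α' < 1)
    (hloc : ∀ c, (cutMulY (𝔸 := 𝔸) (hB i.D c)).restrictScalars ℝ *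
      ((cutMulY (𝔸 := 𝔸) (chiBigT i c)).restrictScalars ℝ * (XY i parS (Oc c) (cfg U₁)).restrictScalars ℝ) * Cl c *
        (cutMulY (𝔸 := 𝔸) (hB i.D c)).restrictScalars ℝ =
      (cutMulY (𝔸 := 𝔸) (hB i.D c)).restrictScalars ℝ * (cutMulY (𝔸 := 𝔸) (hB i.D c)).restrictScalars ℝ)
    (hC : ∀ c, HasMajorant (g := toB6 (geo9K i) Rr Hp) (fun p : BlkY i × ι => ιB p.1) (conj b ((etaS i ^ 2 * etaS i ^ 2)⁻¹ • Cl c))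
      (fun a a' => B₀ * ((geo9K i).len a ^ 4)⁻¹ * Real.exp (-(bb * δ₀ * (geo9K i).dist a a'))))
    (hD : ∀ c, HasMajorant (g := toB6 (geo9K i) Rr Hp) (fun p : BlkY i × ι => ιB p.1)
      (conj b ((etaS i ^ 2 * etaS i ^ 2) • ((cutMulY (𝔸 := 𝔸) (chiBigT i c)).restrictScalars ℝ *
        ((XY i parS O (cfg U₁)).restrictScalars ℝ - (XY i parS (Oc c) (cfg U₁)).restrictScalars ℝ) *
        (cutMulY (𝔸 := 𝔸) (cubeIndT i.D (one_le_Mh i) (four_le_P' i) c)).restrictScalars ℝ)))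
      (fun a a'' => κD * Real.exp (-(2 * δ₀ * DsepT i)) * (geo9K i).len a ^ 4 * Real.exp (-(aD * δ₀ * (geo9K i).dist a a''))))
    (lam : BlkY i → 𝔸) (s₀ : BlkY i) (hsupp : ∀ t, t ≠ s₀ → lam t = 0) (hbd : ‖lam s₀‖ ≤ 1) (t : BlkY i) :
    (etaS i ^ 2 * etaS i ^ 2)⁻¹ * ‖XinvY i parS O (cfg U₁) lam t‖ ≤
      (∑ j, ‖b j‖) * M₂ * ((3 * 5 ^ (d + 1)) * B₀ * B6.c1 d' (ρ * δ₀) α' * (1 - (θ₁ + θ₂ + θ₃) * B6.c1 d' (ρ * δ₀) α')⁻¹) *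
      ((geo9K i).len (ιB t) ^ 4)⁻¹ * Real.exp (-((1 - α') * (ρ * δ₀) * (geo9K i).dist (ιB t) (ιB s₀))) := by
  have hmaj := hasMajorant_conj_XinvY_of_eBlockInv_cover i b cfg O parS ιB (Rr := Rr) (Hp := Hp) Oc hE hEc hBG hι hunit hpar hM₂ hrepr d' d₂ hCG hαGδ
    hα₂0 hα₂1 hδG hSTG h261G hrate Cl hκD hB₀ hC0 hδ₀ hasep hρ hρb hαc hα'1 hsplit₁ hsplit₂ hsplit₃ hκG hθ₁ hθ₂ hθ₃ hST h261b h261 h263 hsmall hloc hC hD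
  have hs0 : 0 ≤ (etaS i ^ 2 * etaS i ^ 2)⁻¹ := inv_nonneg.mpr (mul_nonneg (sq_nonneg _) (sq_nonneg _))
  have hw := norm_apply_le_of_hasMajorant_blk i b ιB ((etaS i ^ 2 * etaS i ^ 2)⁻¹ • (XinvY i parS O (cfg U₁)).restrictScalars ℝ) hM₂ hrepr hmaj lam s₀
    zero_le_one hsupp hbd t
  rw [LinearMap.smul_apply, Pi.smul_apply, LinearMap.restrictScalars_apply, norm_smul, Real.norm_eq_abs, abs_of_nonneg hs0] at hw
  exact hw.trans (le_of_eq (by ring))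

end Main

end Literature.MathematicalPhysics.QuantumFieldTheory.Balaban1983to89.B9Thm39CinvAtCover

end
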